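import Literature.IUT.LogVolume.Theorem110LocalBounds
import HarnessLib

/-!
# [IUTchIV] Theorem 1.10, Step (v) — the `λ_min` variant of the per-collection bound (planner's call R2)

Context (abc-iut cell, plan/c312/STEPV-IND1-NOTE.md; c312-d1's kernel file
`MultiradialRegionInd1Bound.lean`, p406699): the text's per-collection upper bound of Step (v) (p. 27–28,
typed verbatim as `Thm110Local.DstLocal.collBound`: the `q`-term `−(j²/2l)·log(q_{v_j})` is taken at the
distinguished index `i† = j`, and "after passing to weighted averages, the operation of symmetrizing with
respect to the choice of `i†` … does not affect the computation of the upper bound", via Prop. 1.7) is, for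
the `e⃗`-component of the hull of the (Ind1)-symmetrized region, only available by hull-monotonicity in the
WEAKER form in which `log(q_{v_j})` is replaced by `min_k log(q_{v_k})` over the slots of the collection
(`le_of_logμ_hullUTheta_le`). This file — TAKING NO SIDE on which reading of (Ind1) is the intended one —
types that `λ_min` form next to `collBound` and pushes it through the SAME averaging (Prop. 1.7 weights,
procession average over `j`) as `Theorem110LocalBounds.lean`, reporting exactly what survives:

* `collBoundMin`, `collBound_le_collBoundMin` (the `λ_min` bound is weaker, i.e. larger);
* `minAvg D n` = the `λ`-weighted average over `e⃗ ∈ E^{n+1}` of `min_k log(q_{e_k})` (the `m_n` of the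
  note; a finite sum, no closed form) and `wavg_collBoundMin_eq`: the weighted average of `collBoundMin` is
  `(j+1)·log(𝔡^K_{v_ℚ}) − (j²/2l)·m_j + log(𝔰^ℚ_{v_ℚ}) + 4(j+1)·ι·l*` — the text's display with `log(q_{v_ℚ})`
  replaced by `m_j`;
* the three regimes: (a) `minAvg_eq_of_const` — constant `log(q_v)` on `E_{v_ℚ}` (e.g. `|E_{v_ℚ}| = 1`,
  `F_mod = ℚ`): `m_j = log(q_{v_ℚ})`, the text's term is recovered; (c) `le_minAvg`/`minAvg_le_avg` — all
  places bad with `μ_min ≤ log(q_v)`: `μ_min ≤ m_j ≤ log(q_{v_ℚ})`; (b) `minAvg_le_geometric` — if the places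
  with `log(q_v) = 0` carry `λ`-weight fraction `ω`, then `m_j ≤ (max_v log q_v)·(1−ω)^{j+1}`: the `q`-term
  decays geometrically along the procession;
* `procAvg_wavg_le_min` / `hull_bound_of_local_bounds_min` — the surviving inequality: the text's
  `−(1/6)·(l+1)/4·Σ_{v_ℚ} log(q_{v_ℚ})` is replaced by `−Σ_{v_ℚ} (1/l⋇)·Σ_{j=1}^{l⋇} (j²/2l)·m_j(v_ℚ)`, all other
  terms unchanged (`Thm110MinVariant` = that statement as a `Prop` about proof data).
Nothing here asserts that the `λ_min` form is the correct reading; nothing on [IUTchIII] Cor. 3.12.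
-/

noncomputable section

namespace Literature.IUT.LogVolume

open Finset Literature.Algebra.PolynomialIdentities.WeightedAverage

namespace Thm110Local

namespace DstLocal

variable {E : Type*} [Fintype E] [Nonempty E] (D : DstLocal E)

/-! ## The `λ_min` per-collection bound -/

/-- `min_{k ≤ n} f(e_k)` over the slots of a collection `e⃗ ∈ E^{n+1}`. [claim: Mochizuki2012, status: disputed] -/
def tupleMin (f : E → ℝ) {n : ℕ} (e : Fin (n + 1) → E) : ℝ :=
  Finset.univ.inf' Finset.univ_nonempty (fun k => f (e k))

omit [Fintype E] [Nonempty E] in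
/-- `tupleMin f e ≤ f (e k)` for every slot `k`. [folklore] -/
private theorem tupleMin_le (f : E → ℝ) {n : ℕ} (e : Fin (n + 1) → E) (k : Fin (n + 1)) :
    tupleMin f e ≤ f (e k) :=
  Finset.inf'_le _ (Finset.mem_univ k)

omit [Fintype E] [Nonempty E] in
/-- `m ≤ tupleMin f e` if `m ≤ f` everywhere. [folklore] -/
private theorem le_tupleMin (f : E → ℝ) {n : ℕ} (e : Fin (n + 1) → E) {m : ℝ} (h : ∀ v, m ≤ f v) :
    m ≤ tupleMin f e :=
  Finset.le_inf' _ _ fun k _ => h (e k)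

/-- The `λ_min` per-collection bound: `Σ_i log(𝔡^K_{v_i}) − (j²/2l)·min_k log(q_{v_k}) + log(p_{v_ℚ}) +
4(j+1)·ι_{v_ℚ}·l*_mod` (the form hull-monotonicity yields for the `e⃗`-component of the hull of the
(Ind1)-symmetrized region: c312-d1, `le_of_logμ_hullUTheta_le`). [claim: Mochizuki2012, status: disputed] -/
def collBoundMin (l lstar : ℝ) (j : ℕ) (e : Fin (j + 1) → E) : ℝ :=
  (∑ i, D.logDK (e i)) - (j : ℝ) ^ 2 / (2 * l) * tupleMin D.logQ e + D.logp
    + 4 * ((j : ℝ) + 1) * D.iota * lstar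

omit [Nonempty E] in
/-- The `λ_min` bound is WEAKER (larger) than the text's `i† = j` bound (for `l > 0`).
[claim: Mochizuki2012, status: disputed] -/
theorem collBound_le_collBoundMin {l : ℝ} (hl : 0 < l) (lstar : ℝ) (j : ℕ) (e : Fin (j + 1) → E) :
    D.collBound l lstar j e ≤ D.collBoundMin l lstar j e := by
  unfold collBound collBoundMin
  have hmin := tupleMin_le D.logQ e (Fin.last j)
  have hc : 0 ≤ (j : ℝ) ^ 2 / (2 * l) := by positivity
  nlinarith

/-! ## Weighted averages of the `λ_min` bound -/

/-- The denominator `Σ_{e⃗} λ_Πe⃗ > 0`. [folklore] -/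
private theorem den_pos' (n : ℕ) : 0 < ∑ e : Fin n → E, tupleLam D.lam e :=
  Finset.sum_pos (fun e _ => Finset.prod_pos fun i _ => D.lam_pos (e i)) Finset.univ_nonempty

/-- `m_n := ` the `λ`-weighted average over `e⃗ ∈ E^{n+1}` of `min_k log(q_{e_k})` (the expected minimum of
`n+1` independent `λ`-weighted draws of `log(q_v)`; no closed form). [claim: Mochizuki2012, status: disputed] -/
def minAvg (n : ℕ) : ℝ := D.wavg (n + 1) (fun e => tupleMin D.logQ e)

/-- Monotonicity of the weighted average. [folklore] -/
private theorem wavg_mono' (n : ℕ) {B₁ B₂ : (Fin n → E) → ℝ} (h : ∀ e, B₁ e ≤ B₂ e) :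
    D.wavg n B₁ ≤ D.wavg n B₂ := by
  unfold wavg
  exact div_le_div_of_nonneg_right (Finset.sum_le_sum fun e _ =>
    mul_le_mul_of_nonneg_right (h e) (Finset.prod_pos fun i _ => D.lam_pos (e i)).le) (D.den_pos' n).le

/-- Weighted average of a constant. [folklore] -/
private theorem wavg_const' (n : ℕ) (c : ℝ) : D.wavg n (fun _ => c) = c := by
  unfold wavg
  rw [← Finset.mul_sum, mul_div_assoc, div_self (D.den_pos' n).ne', mul_one]

/-- Linearity of the weighted average: `wavg (B + c·B' + d) = wavg B + c·wavg B' + d`. [folklore] -/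
private theorem wavg_affine (n : ℕ) (B B' : (Fin n → E) → ℝ) (c d : ℝ) :
    D.wavg n (fun e => B e + c * B' e + d) = D.wavg n B + c * D.wavg n B' + d := by
  unfold wavg
  have hd := (D.den_pos' n).ne'
  have hsplit : ∑ e : Fin n → E, (B e + c * B' e + d) * tupleLam D.lam e =
      (∑ e : Fin n → E, B e * tupleLam D.lam e) + c * (∑ e : Fin n → E, B' e * tupleLam D.lam e)
        + d * ∑ e : Fin n → E, tupleLam D.lam e := by
    rw [Finset.mul_sum, Finset.mul_sum, ← Finset.sum_add_distrib, ← Finset.sum_add_distrib]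
    refine Finset.sum_congr rfl fun e _ => ?_
    ring
  rw [hsplit]
  field_simp

/-- The weighted average of a single-slot quantity is the plain `λ`-average (Prop. 1.7, second display).
[folklore] -/
private theorem wavg_coord' (f : E → ℝ) (n : ℕ) (i : Fin (n + 1)) :
    D.wavg (n + 1) (fun e => f (e i)) = D.avg f := by
  unfold wavg avg betaAvg
  have h := betaTotal_mul_lamTotal_pow f D.lam n i
  rw [← h, ← lamTotal_pow, pow_succ]
  have hl : lamTotal D.lam ≠ 0 := (lamTotal_pos D.lam_pos).ne'
  have hln : lamTotal D.lam ^ n ≠ 0 := pow_ne_zero _ hl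
  field_simp

/-- The `λ`-average of a constant function. [folklore] -/
private theorem avg_const' {f : E → ℝ} {μ : ℝ} (h : ∀ v, f v = μ) : D.avg f = μ := by
  unfold avg betaAvg betaTotal lamTotal
  have hs : (∑ v, D.lam v) ≠ 0 := (Finset.sum_pos (fun v _ => D.lam_pos v) Finset.univ_nonempty).ne'
  simp_rw [h]
  rw [← Finset.mul_sum, mul_div_assoc, div_self hs, mul_one]

/-- The weighted average of `collBoundMin` via the text's `collBound`: the two differ by the `q`-terms.
[claim: Mochizuki2012, status: disputed] -/
theorem wavg_collBoundMin_eq {l : ℝ} (lstar : ℝ) (j : ℕ) :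
    D.wavg (j + 1) (D.collBoundMin l lstar j) =
      ((j : ℝ) + 1) * D.avg D.logDK - (j : ℝ) ^ 2 / (2 * l) * D.minAvg j + D.logp
        + 4 * ((j : ℝ) + 1) * D.iota * lstar := by
  -- `collBoundMin = collBound + (j²/2l)·(logQ(e_j) − tupleMin)`; average the pieces
  have e1 : D.collBoundMin l lstar j = fun e =>
      D.collBound l lstar j e + (j : ℝ) ^ 2 / (2 * l) * (D.logQ (e (Fin.last j)) - tupleMin D.logQ e) + 0 := by
    funext e; unfold collBound collBoundMin; ring
  rw [e1, D.wavg_affine, D.wavg_collBound_eq]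
  -- the average of `logQ (e_j) − tupleMin` is `avg logQ − minAvg`
  have e2 : (fun e : Fin (j + 1) → E => D.logQ (e (Fin.last j)) - tupleMin D.logQ e) =
      fun e => (fun e : Fin (j + 1) → E => D.logQ (e (Fin.last j))) e + (-1) * tupleMin D.logQ e + 0 := by
    funext e; ring
  have hcoord : D.wavg (j + 1) (fun e : Fin (j + 1) → E => D.logQ (e (Fin.last j))) = D.avg D.logQ :=
    D.wavg_coord' D.logQ j (Fin.last j)
  rw [e2, D.wavg_affine, hcoord]
  unfold minAvg
  ring

/-! ## The three regimes for `m_j` -/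

/-- `m_n ≤ log(q_{v_ℚ})` (the min is at most the value at any fixed slot). [claim: Mochizuki2012, status: disputed] -/
theorem minAvg_le_avg (n : ℕ) : D.minAvg n ≤ D.avg D.logQ := by
  have hcoord : D.wavg (n + 1) (fun e : Fin (n + 1) → E => D.logQ (e 0)) = D.avg D.logQ :=
    D.wavg_coord' D.logQ n 0
  rw [← hcoord]
  exact D.wavg_mono' _ fun e => tupleMin_le D.logQ e 0

/-- Regime (c), lower half: if `μ_min ≤ log(q_v)` for all `v ∈ E_{v_ℚ}` then `μ_min ≤ m_n`.
[claim: Mochizuki2012, status: disputed] -/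
theorem le_minAvg (n : ℕ) {m : ℝ} (h : ∀ v, m ≤ D.logQ v) : m ≤ D.minAvg n := by
  unfold minAvg
  rw [← D.wavg_const' (n + 1) m]
  exact D.wavg_mono' _ fun e => le_tupleMin D.logQ e h

/-- Regime (a): if `log(q_v) = μ` is constant on `E_{v_ℚ}` (e.g. a single place over `v_ℚ`, `F_mod = ℚ`), then
`m_n = μ = log(q_{v_ℚ})` and the text's term is recovered. [claim: Mochizuki2012, status: disputed] -/
theorem minAvg_eq_of_const (n : ℕ) {μ : ℝ} (h : ∀ v, D.logQ v = μ) : D.minAvg n = μ ∧ D.avg D.logQ = μ := by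
  have havg : D.avg D.logQ = μ := D.avg_const' h
  refine ⟨le_antisymm ?_ (D.le_minAvg n fun v => (h v).ge), havg⟩
  calc D.minAvg n ≤ D.avg D.logQ := D.minAvg_le_avg n
    _ = μ := havg

/-- The `λ`-weight of the places with `log(q_v) ≠ 0` ("bad"), as a fraction `1 − ω` of the total weight.
[claim: Mochizuki2012, status: disputed] -/
def badFraction : ℝ := (∑ v, if D.logQ v = 0 then 0 else D.lam v) / lamTotal D.lam

/-- Regime (b): if `log(q_v) ≤ M` on `E_{v_ℚ}` (`M ≥ 0`), then `m_n ≤ M·(1−ω)^{n+1}` where `1 − ω` is the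
`λ`-weight fraction of the places with `log(q_v) ≠ 0`: a single good slot kills the minimum, so the `q`-term
decays geometrically along the procession. [claim: Mochizuki2012, status: disputed] -/
theorem minAvg_le_geometric (n : ℕ) {M : ℝ} (hM0 : 0 ≤ M) (hM : ∀ v, D.logQ v ≤ M) :
    D.minAvg n ≤ M * D.badFraction ^ (n + 1) := by
  classical
  -- pointwise: `min_k logQ(e_k) ≤ M · Π_k 1[logQ(e_k) ≠ 0]`
  set g : E → ℝ := fun v => if D.logQ v = 0 then 0 else D.lam v with hg
  have hg_nonneg : ∀ v, 0 ≤ g v := fun v => by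
    simp only [hg]; split_ifs
    · exact le_rfl
    · exact (D.lam_pos v).le
  have hpt : ∀ e : Fin (n + 1) → E,
      tupleMin D.logQ e * tupleLam D.lam e ≤ M * ∏ k, g (e k) := by
    intro e
    rcases em (∃ k, D.logQ (e k) = 0) with ⟨k, hk⟩ | hnone
    · have hmin : tupleMin D.logQ e ≤ 0 := by rw [← hk]; exact tupleMin_le D.logQ e k
      have hmin0 : 0 ≤ tupleMin D.logQ e := le_tupleMin D.logQ e D.logQ_nonneg
      have : tupleMin D.logQ e = 0 := le_antisymm hmin hmin0
      rw [this, zero_mul]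
      exact mul_nonneg hM0 (Finset.prod_nonneg fun k _ => hg_nonneg (e k))
    · have hall : ∀ k, D.logQ (e k) ≠ 0 := fun k hk => hnone ⟨k, hk⟩
      have hprod : ∏ k, g (e k) = tupleLam D.lam e := by
        unfold tupleLam
        exact Finset.prod_congr rfl fun k _ => by simp [hg, hall k]
      rw [hprod]
      exact mul_le_mul_of_nonneg_right (le_trans (tupleMin_le D.logQ e 0) (hM _))
        (Finset.prod_pos fun i _ => D.lam_pos (e i)).le
  -- sum over collections: `Σ_e Π_k g(e_k) = (Σ_v g v)^{n+1}`
  have hsum : ∑ e : Fin (n + 1) → E, tupleMin D.logQ e * tupleLam D.lam e ≤ M * (∑ v, g v) ^ (n + 1) := by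
    calc ∑ e : Fin (n + 1) → E, tupleMin D.logQ e * tupleLam D.lam e
        ≤ ∑ e : Fin (n + 1) → E, M * ∏ k, g (e k) := Finset.sum_le_sum fun e _ => hpt e
      _ = M * (∑ v, g v) ^ (n + 1) := by rw [← Finset.mul_sum, Fintype.sum_pow]
  unfold minAvg wavg badFraction
  have hden : (∑ e : Fin (n + 1) → E, tupleLam D.lam e) = lamTotal D.lam ^ (n + 1) := (lamTotal_pow _ _).symm
  rw [hden, div_pow, div_le_iff₀ (pow_pos (lamTotal_pos D.lam_pos) _)]
  have hl : lamTotal D.lam ^ (n + 1) ≠ 0 := pow_ne_zero _ (lamTotal_pos D.lam_pos).ne'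
  calc ∑ e : Fin (n + 1) → E, tupleMin D.logQ e * tupleLam D.lam e ≤ M * (∑ v, g v) ^ (n + 1) := hsum
    _ = M * ((∑ v, g v) ^ (n + 1) / lamTotal D.lam ^ (n + 1)) * lamTotal D.lam ^ (n + 1) := by
        field_simp

/-! ## The surviving inequality -/

/-- Linearity of the procession average in the form needed: `procAvg (f − g) = procAvg f − procAvg g`. [folklore] -/
private theorem procAvg_sub (lh : ℕ) (f g : ℕ → ℝ) :
    procAvg lh (fun j => f j - g j) = procAvg lh f - procAvg lh g := by
  unfold procAvg; rw [Finset.sum_sub_distrib, mul_sub]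

/-- **Step (v) at one `v_ℚ`, `λ_min` form**: if the component volumes are bounded by `collBoundMin`, then
their procession-normalized weighted average is `≤ (l+1)/4·{(1 + 4/l)·log(𝔡^K_{v_ℚ}) + (4/l)·log(𝔰^ℚ_{v_ℚ}) +
(20/3)·l*·ι} − (1/l⋇)·Σ_{j=1}^{l⋇} (j²/2l)·m_j` (compare `procAvg_wavg_le`: there the last term is
`−(l+1)/4·(1/6)·log(q_{v_ℚ})`). [claim: Mochizuki2012, status: disputed] -/
theorem procAvg_wavg_le_min {lh : ℕ} (hlh : 2 ≤ lh) {lstar : ℝ} (hlstar : 0 ≤ lstar)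
    (vol : (j : ℕ) → (Fin (j + 1) → E) → ℝ)
    (hvol : ∀ j, 1 ≤ j → j ≤ lh → ∀ e, vol j e ≤ D.collBoundMin (2 * (lh : ℝ) + 1) lstar j e) :
    procAvg lh (fun j => D.wavg (j + 1) (vol j)) ≤
      ((2 * (lh : ℝ) + 1) + 1) / 4 * ((1 + 4 / (2 * (lh : ℝ) + 1)) * D.avg D.logDK
        + 4 / (2 * (lh : ℝ) + 1) * D.logp + 20 / 3 * (D.iota * lstar))
      - procAvg lh (fun j => (j : ℝ) ^ 2 / (2 * (2 * (lh : ℝ) + 1)) * D.minAvg j) := by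
  have hlh1 : 1 ≤ lh := by omega
  have hle : procAvg lh (fun j => D.wavg (j + 1) (vol j)) ≤
      procAvg lh (fun j => D.wavg (j + 1) (D.collBoundMin (2 * (lh : ℝ) + 1) lstar j)) := by
    unfold procAvg
    apply mul_le_mul_of_nonneg_left _ (by positivity)
    refine Finset.sum_le_sum fun j hj => ?_
    rw [Finset.mem_Icc] at hj
    exact D.wavg_mono' _ (hvol j hj.1 hj.2)
  refine le_trans hle ?_
  -- split the averaged bound into the text's linear part (with `q`-coefficient `0`) and the `m_j` part
  have e : (fun j => D.wavg (j + 1) (D.collBoundMin (2 * (lh : ℝ) + 1) lstar j)) = fun j : ℕ =>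
      (((j : ℝ) + 1) * D.avg D.logDK - (j : ℝ) ^ 2 / (2 * (2 * (lh : ℝ) + 1)) * 0 + D.logp
        + 4 * ((j : ℝ) + 1) * (D.iota * lstar))
      - (j : ℝ) ^ 2 / (2 * (2 * (lh : ℝ) + 1)) * D.minAvg j := by
    funext j; rw [D.wavg_collBoundMin_eq]; ring
  rw [e, procAvg_sub, procAvg_linear' hlh1]
  have hA : 0 ≤ D.avg D.logDK := by
    unfold avg betaAvg betaTotal
    exact div_nonneg (Finset.sum_nonneg fun v _ => mul_nonneg (D.logDK_nonneg v) (D.lam_pos v).le)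
      (lamTotal_pos D.lam_pos).le
  have hl5 : (5 : ℝ) ≤ 2 * (lh : ℝ) + 1 := by
    have : (2 : ℝ) ≤ lh := by exact_mod_cast hlh
    linarith
  have h0 := procNormalized_le (B := (0 : ℝ)) hl5 hA D.logp_nonneg (mul_nonneg D.iota_nonneg hlstar)
  simp only [mul_zero, sub_zero] at h0 ⊢
  linarith

/-- The `q`-term of the `λ_min` form is dominated as in regime (b): with `log(q_v) ≤ M` and bad fraction
`1 − ω`, `(1/l⋇)·Σ_j (j²/2l)·m_j ≤ (1/l⋇)·Σ_j (j²/2l)·M·(1−ω)^{j+1}` (geometric decay in `j`; for `ω > 0` this is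
`O(M/(ω³·l·l⋇))`, versus the text's `(l+1)/24·log(q_{v_ℚ})`). [claim: Mochizuki2012, status: disputed] -/
theorem qTermMin_le_geometric (lh : ℕ) {l M : ℝ} (hl : 0 < l) (hM0 : 0 ≤ M) (hM : ∀ v, D.logQ v ≤ M) :
    procAvg lh (fun j => (j : ℝ) ^ 2 / (2 * l) * D.minAvg j) ≤
      procAvg lh (fun j => (j : ℝ) ^ 2 / (2 * l) * (M * D.badFraction ^ (j + 1))) := by
  unfold procAvg
  apply mul_le_mul_of_nonneg_left _ (by positivity)
  exact Finset.sum_le_sum fun j _ =>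
    mul_le_mul_of_nonneg_left (D.minAvg_le_geometric j hM0 hM) (by positivity)

/-- And it is at most the text's `q`-term: `(1/l⋇)·Σ_j (j²/2l)·m_j ≤ (1/l⋇)·Σ_j (j²/2l)·log(q_{v_ℚ})` — the
`λ_min` inequality is implied by, never stronger than, the text's. [claim: Mochizuki2012, status: disputed] -/
theorem qTermMin_le_text (lh : ℕ) {l : ℝ} (hl : 0 < l) :
    procAvg lh (fun j => (j : ℝ) ^ 2 / (2 * l) * D.minAvg j) ≤
      procAvg lh (fun j => (j : ℝ) ^ 2 / (2 * l) * D.avg D.logQ) := by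
  unfold procAvg
  apply mul_le_mul_of_nonneg_left _ (by positivity)
  exact Finset.sum_le_sum fun j _ => mul_le_mul_of_nonneg_left (D.minAvg_le_avg j) (by positivity)

end DstLocal

/-- **The surviving global inequality (`λ_min` form of Steps (v)–(viii), first sentence)**: as
`hull_bound_of_local_bounds`, with the text's `−(l+1)/4·(1/6)·Σ_{v_ℚ} log(q_{v_ℚ})` replaced by
`−Σ_{v_ℚ} (1/l⋇)·Σ_{j=1}^{l⋇} (j²/2l)·m_j(v_ℚ)`. [claim: Mochizuki2012, status: disputed] -/
theorem hull_bound_of_local_bounds_min {ι : Type*} (dst : Finset ι) {E : ι → Type*}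
    [∀ v, Fintype (E v)] [∀ v, Nonempty (E v)] (D : ∀ v, DstLocal (E v))
    {lh : ℕ} (hlh : 2 ≤ lh) {lstar : ℝ} (hlstar : 0 ≤ lstar) (logpi : ℝ)
    (vol : (v : ι) → (j : ℕ) → (Fin (j + 1) → E v) → ℝ)
    (hvol : ∀ v ∈ dst, ∀ j, 1 ≤ j → j ≤ lh → ∀ e,
      vol v j e ≤ (D v).collBoundMin (2 * (lh : ℝ) + 1) lstar j e)
    {negLogTheta Z : ℝ} (hZ : Z ≤ 0)
    (h : negLogTheta ≤ (∑ v ∈ dst, procAvg lh (fun j => (D v).wavg (j + 1) (vol v j))) + Z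
      + procAvg lh (fun j => ((j : ℝ) + 1) * logpi)) :
    negLogTheta ≤
      ((2 * (lh : ℝ) + 1) + 1) / 4 * ((1 + 4 / (2 * (lh : ℝ) + 1)) * (∑ v ∈ dst, (D v).avg (D v).logDK)
        + 4 / (2 * (lh : ℝ) + 1) * (∑ v ∈ dst, (D v).logp)
        + 20 / 3 * lstar * (∑ v ∈ dst, (D v).iota))
      - (∑ v ∈ dst, procAvg lh (fun j => (j : ℝ) ^ 2 / (2 * (2 * (lh : ℝ) + 1)) * (D v).minAvg j))
      + ((2 * (lh : ℝ) + 1) + 5) / 4 * logpi := by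
  have hlh1 : 1 ≤ lh := by omega
  have hsum : (∑ v ∈ dst, procAvg lh (fun j => (D v).wavg (j + 1) (vol v j))) ≤
      ∑ v ∈ dst, (((2 * (lh : ℝ) + 1) + 1) / 4 * ((1 + 4 / (2 * (lh : ℝ) + 1)) * (D v).avg (D v).logDK
        + 4 / (2 * (lh : ℝ) + 1) * (D v).logp + 20 / 3 * ((D v).iota * lstar))
        - procAvg lh (fun j => (j : ℝ) ^ 2 / (2 * (2 * (lh : ℝ) + 1)) * (D v).minAvg j)) :=
    Finset.sum_le_sum fun v hv => (D v).procAvg_wavg_le_min hlh hlstar (vol v) (hvol v hv)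
  rw [procAvg_arch hlh1] at h
  rw [Finset.sum_sub_distrib] at hsum
  have hlin : ∑ v ∈ dst, ((2 * (lh : ℝ) + 1) + 1) / 4 * ((1 + 4 / (2 * (lh : ℝ) + 1)) * (D v).avg (D v).logDK
      + 4 / (2 * (lh : ℝ) + 1) * (D v).logp + 20 / 3 * ((D v).iota * lstar)) =
      ((2 * (lh : ℝ) + 1) + 1) / 4 * ((1 + 4 / (2 * (lh : ℝ) + 1)) * (∑ v ∈ dst, (D v).avg (D v).logDK)
        + 4 / (2 * (lh : ℝ) + 1) * (∑ v ∈ dst, (D v).logp)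
        + 20 / 3 * lstar * (∑ v ∈ dst, (D v).iota)) := by
    rw [Finset.mul_sum, Finset.mul_sum, Finset.mul_sum, ← Finset.sum_add_distrib, ← Finset.sum_add_distrib,
      Finset.mul_sum]
    refine Finset.sum_congr rfl fun v _ => ?_
    ring
  rw [hlin] at hsum
  linarith

/-- **`Thm110MinVariant`** — the typed statement "the `λ_min` per-collection bounds hold for the component
volumes" ⟹ the surviving inequality, as a `Prop` about local proof data (for the planners'/referees'
comparison with `Thm110Numerics.ProofData.hull_le`; R2 of plan/c312/STEPV-IND1-NOTE.md). It is PROVED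
(`thm110MinVariant_holds`). [claim: Mochizuki2012, status: disputed] -/
def Thm110MinVariant : Prop :=
  ∀ {ι : Type} (dst : Finset ι) {E : ι → Type} [∀ v, Fintype (E v)] [∀ v, Nonempty (E v)]
    (D : ∀ v, DstLocal (E v)) {lh : ℕ}, 2 ≤ lh → ∀ {lstar : ℝ}, 0 ≤ lstar → ∀ (logpi : ℝ)
    (vol : (v : ι) → (j : ℕ) → (Fin (j + 1) → E v) → ℝ),
    (∀ v ∈ dst, ∀ j, 1 ≤ j → j ≤ lh → ∀ e, vol v j e ≤ (D v).collBoundMin (2 * (lh : ℝ) + 1) lstar j e) →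
    ∀ {negLogTheta Z : ℝ}, Z ≤ 0 →
    negLogTheta ≤ (∑ v ∈ dst, procAvg lh (fun j => (D v).wavg (j + 1) (vol v j))) + Z
      + procAvg lh (fun j => ((j : ℝ) + 1) * logpi) →
    negLogTheta ≤
      ((2 * (lh : ℝ) + 1) + 1) / 4 * ((1 + 4 / (2 * (lh : ℝ) + 1)) * (∑ v ∈ dst, (D v).avg (D v).logDK)
        + 4 / (2 * (lh : ℝ) + 1) * (∑ v ∈ dst, (D v).logp)
        + 20 / 3 * lstar * (∑ v ∈ dst, (D v).iota))
      - (∑ v ∈ dst, procAvg lh (fun j => (j : ℝ) ^ 2 / (2 * (2 * (lh : ℝ) + 1)) * (D v).minAvg j))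
      + ((2 * (lh : ℝ) + 1) + 5) / 4 * logpi

/-- `Thm110MinVariant` holds. [claim: Mochizuki2012, status: disputed] -/
theorem thm110MinVariant_holds : Thm110MinVariant :=
  fun dst _ _ _ D _ hlh _ hlstar logpi vol hvol _ _ hZ h =>
    hull_bound_of_local_bounds_min dst D hlh hlstar logpi vol hvol hZ h

/-- `Thm110MinVariant` — `_holds` alias of `thm110MinVariant_holds` above under the fact's exact name (appended
2026-08-28, D-0026 bookkeeping: the proof term is the existing theorem of this file; no statement,
definition or attribute is edited; no new named fact; the ledger's debt table listed the fact
unproved). [claim: Mochizuki2012, status: disputed] -/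
theorem _root_.Literature.IUT.LogVolume.Thm110Local.Thm110MinVariant_holds : Thm110MinVariant :=
  _root_.Literature.IUT.LogVolume.Thm110Local.thm110MinVariant_holds

end Thm110Local

end Literature.IUT.LogVolume

end
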